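import Mathlib
import HarnessLib
import Literature.Analysis.FluidPDE.TypeIAncientMild
import Literature.Analysis.FluidPDE.AdaptedBackwardKernel
import Summits.NavierStokesRegularity.NavierStokesRegularity.Theorems.AdaptedFrequencyAdaptedKernelExists
import Summits.NavierStokesRegularity.NavierStokesRegularity.Theorems.AdaptedFrequencyTangentFlowTransferKernelCalculusGlobal
import Summits.NavierStokesRegularity.NavierStokesRegularity.Theorems.AdaptedFrequencyAdaptedFrequencyConvergesStubEnstrophyC2Tools
import Summits.NavierStokesRegularity.NavierStokesRegularity.Theorems.TypeICertificateLadderTargetHeadFluxCriterion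

/-!
# Route `LocalPressureProfileDoor`, crux K2⁺ `MonotonePressureProfileRigidity` (stmt-NavierStokesRegularity-20180),
# line `birth`, stub `stub_smallSliceOfMonotonePressure` — helper 1/4: the ADAPTED BACKWARD KERNEL AT THE APEX of a
# Type-I ancient mild profile, and the pairing calculus against it

Cell ns-regularity-ideate, seat ns-pressure-K2-p1 (LEAD; helper file, lands `--supports stmt-NavierStokesRegularity-20180`).

The line's card asks for an "eternal adjoint weight" with a UNIFORM floor (its why-might-fail).  That object is
already a tree theorem: `linearTypeIDriftKernel` (crux `AdaptedKernelExists` of route `AdaptedFrequency`, PROVED) — every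
jointly smooth, divergence-free drift with the Type-I rate `‖b(t,x)‖ ≤ C/√(T−t)` admits an adapted backward kernel of
`∂ₜ + b·∇ − Δ` with pole `(T, x₀)` and TWO-SIDED Gaussian bounds `c₁(T−t)^{−3/2}e^{−‖x−x₀‖²/(c₂(T−t))} ≤ G ≤ C₁(…)`.
For a profile `v` of the Type-I ancient mild class (`IsTypeIAncientMild D v`) we take the pole AT THE APEX `(0, 0)`:

* `exists_apexKernel` — a kernel `G` of `∂ₜ + v·∇ − Δ` on `[−1, 0) × ℝ³` with pole `(0,0)`, unit mass, and the two-sided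
  bounds; in Leray variables `w(s,y) = (−t)^{3/2} G(t, √(−t)y)` this is a positive unit-mass solution of the ADJOINT
  Leray equation squeezed between two fixed Gaussians — floor and tightness uniformly in `s`, for free;
* `apexKernel_le_window` / `integrable_gaussianMajorant` — on a window `(a, b)`, `−1 ≤ a < b < 0`, one integrable Gaussian
  majorant;
* `hasDerivAt_pairing_window` — the transport-free first variation `d/dt ∫ q G = ∫ (∂ₜq + v·∇q − Δq) G` for jointly smooth
  test fields `q` bounded with their first two space derivatives and their time derivative on the window (tree
  `hasDerivAt_integral_mul_kernel_of_bounds`, Friedman 1964 Ch. 1 §8);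
* `continuousOn_pairing_window`, `abs_pairing_le` — continuity of `t ↦ ∫ q(t)G(t)` (dominated convergence, tree
  `enstrophyC2_continuousOn_integral_mul`) and `|∫ q G| ≤ sup|q|` (unit mass);
* `setIntegral_ball_le_of_pairing` — the floor: `c₁(−t)^{−3/2}e^{−ρ²/(c₂(−t))} ∫_{B(0,ρ)} f ≤ ∫ f G(t)` for `f ≥ 0`.

WHAT THIS IS NOT: not a claim about Navier–Stokes regularity; kernel bookkeeping for the budget of the L stub
(bears_on LADDER-NS N0, rung N0-LocalTubeDoorPressureProfile).
-/

noncomputable section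

set_option linter.dupNamespace false -- the summit and its sub-problem share the name (CONVENTIONS §1)

namespace Summit.NavierStokesRegularity.NavierStokesRegularity.Theorems.LocalPressureProfileDoorMonotonePressureProfileRigiditySmallSliceKernel

open MeasureTheory Set Function Filter Metric Topology
open scoped ENNReal NNReal InnerProductSpace RealInnerProductSpace Laplacian ContDiff
open Literature.Analysis Literature.Analysis.FluidPDE
open Summit.NavierStokesRegularity.NavierStokesRegularity.Theorems (linearTypeIDriftKernel
  hasDerivAt_integral_mul_kernel_of_bounds headFlux_integrable_exp_neg_mul_sq_norm)
open Summit.NavierStokesRegularity.NavierStokesRegularity.Theorems.AdaptedFrequencyConverges.UnsteadinessSqueeze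
  (enstrophyC2_continuousOn_integral_mul)

/-! ### The kernel at the apex -/

/-- **The adapted backward kernel at the apex of a Type-I ancient mild profile.**  For `v` in the class
`IsTypeIAncientMild D v` (jointly smooth on `t < 0`, divergence free, Oseen–Duhamel mild, `‖v‖ ≤ D/√(−t)`) there are
constants `c₁, c₂, C₁, C₂ > 0` and `G : ℝ → ℝ³ → ℝ` which is an adapted backward kernel of `∂ₜ + v·∇ − Δ` on `[−1,0)` with
pole `(0, 0)` (`IsAdaptedBackwardKernel 1 v (Ico (−1) 0) 0 0 G`: jointly `C²`, positive, `∂ₜG + v·∇G + ΔG = 0`, unit mass,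
`G(t)dx ⇀ δ₀`) and obeys `c₁(−t)^{−3/2}e^{−‖x‖²/(c₂(−t))} ≤ G(t,x) ≤ C₁(−t)^{−3/2}e^{−‖x‖²/(C₂(−t))}` — the tree's linear
kernel theorem `linearTypeIDriftKernel` for the drift `v` on `[−2, 0)`. [cite: KochNadirashviliSereginSverak2009, §4 p. 8 (arXiv:0709.3599)] -/
theorem exists_apexKernel {D : ℝ} {v : ℝ → EuclideanSpace ℝ (Fin 3) → EuclideanSpace ℝ (Fin 3)}
    (hA : IsTypeIAncientMild D v) :
    ∃ (G : ℝ → EuclideanSpace ℝ (Fin 3) → ℝ) (c₁ c₂ C₁ C₂ : ℝ), 0 < c₁ ∧ 0 < c₂ ∧ 0 < C₁ ∧ 0 < C₂ ∧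
      IsAdaptedBackwardKernel 1 v (Ico (-1 : ℝ) 0) 0 0 G ∧
      (∀ t ∈ Ico (-1 : ℝ) 0, ∀ x : EuclideanSpace ℝ (Fin 3),
        c₁ * (-t) ^ (-(3 : ℝ) / 2) * Real.exp (-(‖x‖ ^ 2) / (c₂ * (-t))) ≤ G t x) ∧
      (∀ t ∈ Ico (-1 : ℝ) 0, ∀ x : EuclideanSpace ℝ (Fin 3),
        G t x ≤ C₁ * (-t) ^ (-(3 : ℝ) / 2) * Real.exp (-(‖x‖ ^ 2) / (C₂ * (-t)))) := by
  have hD0 : 0 ≤ D := hA.nonneg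
  obtain ⟨c₁, c₂, C₁, C₂, hc₁, hc₂, hC₁, hC₂, hall⟩ := linearTypeIDriftKernel 1 D one_pos hD0
  have hsub : Ico (-2 : ℝ) 0 ⊆ Iio 0 := fun t ht => ht.2
  have hsm : IsSmoothSpaceTimeOn (Ico (-2 : ℝ) 0) v :=
    (show IsSmoothSpaceTimeOn (Iio 0) v from hA.contDiffOn).mono hsub
  have hdiv : ∀ t ∈ Ico (-2 : ℝ) 0, VectorCalculus.IsDivFree (v t) := fun t ht => hA.isDivFree ht.2
  have hrate : ∀ t ∈ Ico (-2 : ℝ) 0, ∀ x, ‖v t x‖ ≤ D / Real.sqrt (0 - t) := fun t ht x => by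
    rw [zero_sub]; exact hA.norm_le ht.2 x
  obtain ⟨G, hK, hlow, hup⟩ := hall (-2) (-1) 0 v 0 (by norm_num) (by norm_num) hsm hdiv hrate
  refine ⟨G, c₁, c₂, C₁, C₂, hc₁, hc₂, hC₁, hC₂, hK, fun t ht x => ?_, fun t ht x => ?_⟩
  · have h := hlow t ht x; rwa [sub_zero, zero_sub] at h
  · have h := hup t ht x; rwa [sub_zero, zero_sub] at h

/-! ### One Gaussian majorant on a window -/

/-- The Gaussian majorant of the kernel on the window `(a, b)`, `−1 ≤ a < b < 0`:
`K * exp(−‖x‖²/C₂)` with `K = C₁ (−b)^{−3/2}`; integrable. [folklore] -/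
theorem integrable_gaussianMajorant (K : ℝ) {C₂ : ℝ} (hC₂ : 0 < C₂) :
    Integrable (fun x : EuclideanSpace ℝ (Fin 3) => K * Real.exp (-(‖x‖ ^ 2) / C₂)) := by
  have h := (headFlux_integrable_exp_neg_mul_sq_norm (inv_pos.2 hC₂)).const_mul K
  refine h.congr (Eventually.of_forall fun x => ?_)
  show K * Real.exp (-C₂⁻¹ * ‖x‖ ^ 2) = K * Real.exp (-(‖x‖ ^ 2) / C₂)
  congr 2
  rw [div_eq_mul_inv, neg_mul, neg_mul, mul_comm]

/-- **The kernel is dominated on a window.**  On `(a, b) × ℝ³` with `−1 ≤ a < b < 0` the upper Gaussian bound gives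
`G(t,x) ≤ C₁(−b)^{−3/2} e^{−‖x‖²/C₂}` (`(−t)^{−3/2} ≤ (−b)^{−3/2}` and `−t ≤ 1`). [folklore] -/
theorem apexKernel_le_window {G : ℝ → EuclideanSpace ℝ (Fin 3) → ℝ} {C₁ C₂ a b : ℝ} (hC₁ : 0 ≤ C₁)
    (hC₂ : 0 < C₂) (ha : -1 ≤ a) (hb : b < 0)
    (hup : ∀ t ∈ Ico (-1 : ℝ) 0, ∀ x : EuclideanSpace ℝ (Fin 3),
      G t x ≤ C₁ * (-t) ^ (-(3 : ℝ) / 2) * Real.exp (-(‖x‖ ^ 2) / (C₂ * (-t)))) :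
    ∀ t ∈ Ioo a b, ∀ x : EuclideanSpace ℝ (Fin 3),
      G t x ≤ C₁ * (-b) ^ (-(3 : ℝ) / 2) * Real.exp (-(‖x‖ ^ 2) / C₂) := by
  intro t ht x
  have ht0 : 0 < -t := by linarith [ht.2]
  have hb0 : 0 < -b := by linarith
  have ht1 : -t ≤ 1 := by linarith [ht.1]
  refine (hup t ⟨by linarith [ht.1], by linarith [ht.2]⟩ x).trans ?_
  have h1 : (-t) ^ (-(3 : ℝ) / 2) ≤ (-b) ^ (-(3 : ℝ) / 2) :=
    Real.rpow_le_rpow_of_nonpos hb0 (by linarith [ht.2]) (by norm_num)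
  have h2 : Real.exp (-(‖x‖ ^ 2) / (C₂ * (-t))) ≤ Real.exp (-(‖x‖ ^ 2) / C₂) := by
    rw [Real.exp_le_exp, neg_div, neg_div, neg_le_neg_iff]
    exact div_le_div_of_nonneg_left (sq_nonneg _) (by positivity) (mul_le_of_le_one_right hC₂.le ht1)
  exact mul_le_mul (mul_le_mul_of_nonneg_left h1 hC₁) h2 (Real.exp_nonneg _) (by positivity)

/-! ### The first variation on a window -/

/-- **Transport-free first variation against the apex kernel on a window.**  Let `v` be a Type-I ancient mild
profile, `G` an adapted backward kernel of `∂ₜ + v·∇ − Δ` on `[−1,0)` with the upper Gaussian bound, and `(a, b)` a window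
with `−1 ≤ a < b < 0`.  For a test field `q` jointly smooth on `(a,b) × ℝ³` with `|q|, ‖Dq‖, |Δq|, |∂ₜq| ≤ M` there,
`d/dt ∫ q(t,x) G(t,x) dx = ∫ (∂ₜq + v·∇q − Δq)(t,x) G(t,x) dx` at every `t ∈ (a, b)` — the tree's
`hasDerivAt_integral_mul_kernel_of_bounds` (cut-offs, the compactly supported first variation, dominated convergence),
with the drift bounded by `D/√(−b)` on the window and the one-sided time derivative of the kernel clause on `[−1,0)`
equal to the two-sided one at interior times. [cite: KochNadirashviliSereginSverak2009, §4 p. 8 (arXiv:0709.3599)] -/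
theorem hasDerivAt_pairing_window {D : ℝ} {v : ℝ → EuclideanSpace ℝ (Fin 3) → EuclideanSpace ℝ (Fin 3)}
    (hA : IsTypeIAncientMild D v) {G : ℝ → EuclideanSpace ℝ (Fin 3) → ℝ}
    (hK : IsAdaptedBackwardKernel 1 v (Ico (-1 : ℝ) 0) 0 0 G) {C₁ C₂ : ℝ} (hC₁ : 0 ≤ C₁) (hC₂ : 0 < C₂)
    (hup : ∀ t ∈ Ico (-1 : ℝ) 0, ∀ x : EuclideanSpace ℝ (Fin 3),
      G t x ≤ C₁ * (-t) ^ (-(3 : ℝ) / 2) * Real.exp (-(‖x‖ ^ 2) / (C₂ * (-t))))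
    {a b : ℝ} (ha : -1 ≤ a) (hb : b < 0) {q : ℝ → EuclideanSpace ℝ (Fin 3) → ℝ}
    (hq : IsSmoothSpaceTimeOn (Ioo a b) q) {M : ℝ}
    (hbd : ∀ t ∈ Ioo a b, ∀ x, |q t x| ≤ M ∧ ‖fderiv ℝ (q t) x‖ ≤ M ∧ |(Δ (q t)) x| ≤ M ∧
      |timeDerivWithin (Ioo a b) q t x| ≤ M)
    {t : ℝ} (ht : t ∈ Ioo a b) :
    HasDerivAt (fun s => ∫ x, q s x * G s x)
      (∫ x, (timeDerivWithin (Ioo a b) q t x + fderiv ℝ (q t) x (v t x) - (Δ (q t)) x) * G t x) t := by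
  set S : Set ℝ := Ioo a b with hS_def
  have hS : IsOpen S := isOpen_Ioo
  have hSI : S ⊆ Ico (-1 : ℝ) 0 := fun s hs => ⟨by linarith [hs.1], by linarith [hs.2]⟩
  have hSI' : S ⊆ Iio (0 : ℝ) := fun s hs => (hSI hs).2
  -- the kernel on the window
  have hG : ContDiffOn ℝ 2 (uncurry G) (S ×ˢ univ) := hK.contDiffOn.mono (prod_mono hSI Subset.rfl)
  have hadj : ∀ s ∈ S, ∀ x, timeDerivWithin S G s x + fderiv ℝ (G s) x (v s x) + 1 * (Δ (G s)) x = 0 := by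
    intro s hs x
    have h := hK.adjoint_eq s (hSI hs) x
    have h1 : timeDerivWithin S G s x = timeDerivWithin (Ico (-1 : ℝ) 0) G s x := by
      rw [timeDerivWithin_apply, timeDerivWithin_apply, derivWithin_of_mem_nhds (hS.mem_nhds hs),
        derivWithin_of_mem_nhds]
      exact mem_of_superset (hS.mem_nhds hs) hSI
    rw [h1]; exact h
  have hG0 : ∀ s ∈ S, ∀ x, 0 ≤ G s x := fun s hs x => (hK.pos s (hSI hs) x).le
  have hdom := apexKernel_le_window hC₁ hC₂ ha hb hup
  -- the drift on the window
  have hu : IsSmoothSpaceTimeOn S v := (show IsSmoothSpaceTimeOn (Iio 0) v from hA.contDiffOn).mono hSI'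
  have hdiv : ∀ s ∈ S, ∀ x, VectorCalculus.divergence (v s) x = 0 := fun s hs x => hA.isDivFree (hSI' hs) x
  have hD0 : 0 ≤ D := hA.nonneg
  have hb0 : 0 < -b := by linarith
  have hvb : ∀ s ∈ S, ∀ x, ‖v s x‖ ≤ D / Real.sqrt (-b) := by
    intro s hs x
    refine (hA.norm_le (hSI' hs) x).trans ?_
    exact div_le_div_of_nonneg_left hD0 (Real.sqrt_pos.2 hb0)
      (Real.sqrt_le_sqrt (by linarith [hs.2]))
  -- one constant
  set M' : ℝ := max M (D / Real.sqrt (-b)) with hM'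
  have hbd' : ∀ s ∈ S, ∀ x, |q s x| ≤ M' ∧ ‖fderiv ℝ (q s) x‖ ≤ M' ∧ |(Δ (q s)) x| ≤ M' ∧
      |timeDerivWithin S q s x| ≤ M' ∧ ‖v s x‖ ≤ M' := by
    intro s hs x
    obtain ⟨h1, h2, h3, h4⟩ := hbd s hs x
    exact ⟨h1.trans (le_max_left _ _), h2.trans (le_max_left _ _), h3.trans (le_max_left _ _),
      h4.trans (le_max_left _ _), (hvb s hs x).trans (le_max_right _ _)⟩
  have key := hasDerivAt_integral_mul_kernel_of_bounds (ν := 1) hS hG hadj hG0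
    (integrable_gaussianMajorant (C₁ * (-b) ^ (-(3 : ℝ) / 2)) hC₂) hdom hu hdiv hq hbd' ht
  simpa only [one_mul] using key

/-! ### Continuity and size of the pairings -/

/-- **Continuity of `t ↦ ∫ q(t) G(t)` on a window** for a jointly smooth bounded test field (dominated convergence with
the Gaussian majorant; tree `enstrophyC2_continuousOn_integral_mul`). [folklore] -/
theorem continuousOn_pairing_window {G : ℝ → EuclideanSpace ℝ (Fin 3) → ℝ} {v : ℝ → EuclideanSpace ℝ (Fin 3) → EuclideanSpace ℝ (Fin 3)}
    (hK : IsAdaptedBackwardKernel 1 v (Ico (-1 : ℝ) 0) 0 0 G) {C₁ C₂ : ℝ} (hC₁ : 0 ≤ C₁) (hC₂ : 0 < C₂)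
    (hup : ∀ t ∈ Ico (-1 : ℝ) 0, ∀ x : EuclideanSpace ℝ (Fin 3),
      G t x ≤ C₁ * (-t) ^ (-(3 : ℝ) / 2) * Real.exp (-(‖x‖ ^ 2) / (C₂ * (-t))))
    {a b : ℝ} (ha : -1 ≤ a) (hb : b < 0) {q : ℝ → EuclideanSpace ℝ (Fin 3) → ℝ}
    (hq : IsSmoothSpaceTimeOn (Ioo a b) q) {M : ℝ} (hbd : ∀ t ∈ Ioo a b, ∀ x, |q t x| ≤ M) :
    ContinuousOn (fun s => ∫ x, q s x * G s x) (Ioo a b) := by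
  have hSI : Ioo a b ⊆ Ico (-1 : ℝ) 0 := fun s hs => ⟨by linarith [hs.1], by linarith [hs.2]⟩
  exact enstrophyC2_continuousOn_integral_mul hq (hK.contDiffOn.mono (prod_mono hSI Subset.rfl))
    (fun s hs x => (hK.pos s (hSI hs) x).le) (integrable_gaussianMajorant (C₁ * (-b) ^ (-(3 : ℝ) / 2)) hC₂)
    (apexKernel_le_window hC₁ hC₂ ha hb hup) hbd

/-- **`|∫ q G(t)| ≤ M`** for `|q| ≤ M` continuous: unit mass and positivity of the kernel. [folklore] -/
theorem abs_pairing_le {G : ℝ → EuclideanSpace ℝ (Fin 3) → ℝ} {v : ℝ → EuclideanSpace ℝ (Fin 3) → EuclideanSpace ℝ (Fin 3)}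
    {S : Set ℝ} (hK : IsAdaptedBackwardKernel 1 v S 0 0 G) {t : ℝ} (ht : t ∈ S)
    {f : EuclideanSpace ℝ (Fin 3) → ℝ} (hf : Continuous f) {M : ℝ} (hM : ∀ x, |f x| ≤ M) :
    |∫ x, f x * G t x| ≤ M := by
  have hGi : Integrable (G t) := hK.integrable ht
  have hM0 : 0 ≤ M := (abs_nonneg _).trans (hM 0)
  have hfG : Integrable (fun x => f x * G t x) := by
    refine Integrable.mono' (hGi.norm.const_mul M) (hf.aestronglyMeasurable.mul hGi.aestronglyMeasurable)
      (Eventually.of_forall fun x => ?_)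
    rw [Real.norm_eq_abs, abs_mul, Real.norm_eq_abs]
    exact mul_le_mul_of_nonneg_right (hM x) (abs_nonneg _)
  calc |∫ x, f x * G t x| ≤ ∫ x, |f x * G t x| := abs_integral_le_integral_abs
    _ ≤ ∫ x, M * G t x := by
        refine integral_mono hfG.abs (hGi.const_mul M) fun x => ?_
        show |f x * G t x| ≤ M * G t x
        rw [abs_mul, abs_of_pos (hK.pos t ht x)]
        exact mul_le_mul_of_nonneg_right (hM x) (hK.pos t ht x).le
    _ = M := by rw [integral_const_mul, hK.integral_eq_one t ht, mul_one]

/-! ### The floor: pairings dominate ball integrals -/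

/-- **The floor of the kernel on a ball.**  With the lower Gaussian bound, for `t ∈ [−1,0)`, a radius `ρ` and a
nonnegative continuous `f` integrable against `G(t)`: `c₁(−t)^{−3/2}e^{−ρ²/(c₂(−t))} ∫_{B(0,ρ)} f ≤ ∫ f G(t)`
(`G(t,x) ≥ c₁(−t)^{−3/2}e^{−ρ²/(c₂(−t))}` on the ball). [folklore] -/
theorem setIntegral_ball_le_of_pairing {G : ℝ → EuclideanSpace ℝ (Fin 3) → ℝ} {c₁ c₂ : ℝ} (hc₁ : 0 ≤ c₁) (hc₂ : 0 < c₂)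
    (hlow : ∀ t ∈ Ico (-1 : ℝ) 0, ∀ x : EuclideanSpace ℝ (Fin 3),
      c₁ * (-t) ^ (-(3 : ℝ) / 2) * Real.exp (-(‖x‖ ^ 2) / (c₂ * (-t))) ≤ G t x)
    {t : ℝ} (ht : t ∈ Ico (-1 : ℝ) 0) {ρ : ℝ} {f : EuclideanSpace ℝ (Fin 3) → ℝ} (hf0 : ∀ x, 0 ≤ f x)
    (hfi : IntegrableOn f (ball 0 ρ)) (hfG : Integrable fun x => f x * G t x) :
    c₁ * (-t) ^ (-(3 : ℝ) / 2) * Real.exp (-(ρ ^ 2) / (c₂ * (-t))) * ∫ x in ball 0 ρ, f x ≤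
      ∫ x, f x * G t x := by
  have ht0 : 0 < -t := by linarith [ht.2]
  set κ : ℝ := c₁ * (-t) ^ (-(3 : ℝ) / 2) * Real.exp (-(ρ ^ 2) / (c₂ * (-t))) with hκ
  have hκ0 : 0 ≤ κ := by positivity
  have hGκ : ∀ x ∈ ball (0 : EuclideanSpace ℝ (Fin 3)) ρ, κ ≤ G t x := by
    intro x hx
    rw [mem_ball, dist_zero_right] at hx
    refine le_trans ?_ (hlow t ht x)
    have hx2 : ‖x‖ ^ 2 ≤ ρ ^ 2 := by
      have := norm_nonneg x
      nlinarith
    have h1 : Real.exp (-(ρ ^ 2) / (c₂ * (-t))) ≤ Real.exp (-(‖x‖ ^ 2) / (c₂ * (-t))) := by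
      refine Real.exp_le_exp.2 (div_le_div_of_nonneg_right ?_ (by positivity))
      linarith
    exact mul_le_mul_of_nonneg_left h1 (by positivity)
  have hfGnn : ∀ x, 0 ≤ f x * G t x := fun x =>
    mul_nonneg (hf0 x) (le_trans (by positivity) (hlow t ht x))
  calc κ * ∫ x in ball 0 ρ, f x = ∫ x in ball 0 ρ, κ * f x := (integral_const_mul _ _).symm
    _ ≤ ∫ x in ball 0 ρ, f x * G t x := by
        refine setIntegral_mono_on (hfi.const_mul κ) hfG.integrableOn measurableSet_ball fun x hx => ?_
        rw [mul_comm]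
        exact mul_le_mul_of_nonneg_left (hGκ x hx) (hf0 x)
    _ ≤ ∫ x, f x * G t x := setIntegral_le_integral hfG (Eventually.of_forall hfGnn)

end Summit.NavierStokesRegularity.NavierStokesRegularity.Theorems.LocalPressureProfileDoorMonotonePressureProfileRigiditySmallSliceKernel

end
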